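/-
Copyright (c) 2026 the pub-hodgecm-mathlib formalisation cell (harness21).  Prover seat hodgecm-mathlib-F0P2-p08 (g2), Track B «K2-LIT»,
#184♮ = hLiu418 = `stmt-HodgeConjecture-24832`; socket #41 `sig_K2LiuSiegelEisensteinContinuation`, KIND W, (x-a) edition-2 input (desk ruling 2026-09-04T22:15:21Z ∕
LEAD F0P6-plan (g14) BATCH #66 (4)): FUBINI OF THE JOINT ARCHIMEDEAN × `T` WHITTAKER INTEGRAL INTO LOCAL INTEGRALS for a ⊗-pure (or finite-Σ-of-⊗-pure) `T`-part.
THEOREMS ONLY (no `def`, no `instance`, no notation, no named-fact hypothesis, no `sorry`).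
-/
import Summits.HodgeConjecture.HodgeConjecture.Theorems.K2LiuWhittakerDeltaEulerProduct   -- ★ G1 (tokens: `unipDeltaArch`, `unipDeltaLoc`, `unipDeltaChar`, `archToAdelic`, `locToAdelic`, `weylDelta`)
import Mathlib.MeasureTheory.Integral.Pi
import HarnessLib

/-!
# Crux `HLiu418`, socket #41, KIND W — `K2LiuSiegelEisensteinKindWPartFubini`: THE JOINT ARCHIMEDEAN × `T` WHITTAKER INTEGRAL OF A ⊗-PURE `T`-PART IS THE PRODUCT OF
# THE LOCAL WHITTAKER INTEGRALS — `I_T(S,s,h) = W_{S,∞}(s,h_∞) · ∏_{v∈T} W_{S,v}(s,h_v)` (and its finite-sum-of-pure-tensors twin)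

Cell `hodgecm-mathlib`, crux item hLiu418 = `stmt-HodgeConjecture-24832`, route of record `HCCMUnconditional`; squad K2 ∕ K2Liu, road `K2_Liu`, socket #41
`sig_K2LiuSiegelEisensteinContinuation`, KIND W (TOP ED. 15 ★ p862237 :176–196).  LEAD F0P6-plan (g14) BATCH #62 (1) ∕ #66 (4), desk K2E5-p17 (g8) RULING
2026-09-04T22:15:21Z: the TOP's letter `A` is the CONTINUED `T`-part, ∃-bound, «with `A = kindWPart …` on the half-plane of convergence by ★ G1 + FUBINI + “continued =
integral” per place» and a PER-PLACE PRESENTATION over continued local Whittaker functions.  THIS FILE is the FUBINI step, generic and then in ★ G1's tokens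
(lane `--supports stmt-HodgeConjecture-24832`, count-neutral helper; closes no socket by itself):
* §1 `integral_prod_pi_tensor` — on `μ ⊗ ⊗_{i∈ι} ν_i` (`ι` finite): `∫ (φ(x)·∏ᵢ ψᵢ(yᵢ)) · (g(x)·∏ᵢ kᵢ(yᵢ)) = (∫ φ·g dμ) · ∏ᵢ ∫ ψᵢ·kᵢ dνᵢ` — Mathlib `integral_prod_mul` ×
  `integral_fintype_prod_eq_prod` (no integrability needed: both sides vanish together); `integral_prod_pi_sum_tensor` — the finite-Σ-of-⊗-pure twin (integrability of
  each term BY VALUE, for the linearity of `∫`).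
* §2 **`jointWhittaker_eq_mul_prod_of_tensor`** — ★ G1 `whittakerDelta_eq_mul_tprod_euler`'s joint integral (the body of (x-a) ED. 1 `K2LiuSiegelEisensteinKindWLetters.kindWPart`,
  written out) for a ⊗-PURE `T`-part `fT_s(a, x) = F_∞(s)(a) · ∏_{v∈T} F_v(s)(x_v)`:
  `I_T(S,s,h) = (∫ conj ψ_S(p_∞,1) · F_∞(s)(w_Δ p_∞ h_∞) dν_∞) · ∏_{v∈T} ∫ conj ψ_S(ι_v y) · F_v(s)((w_Δ)_v y h_v) dν_v` — the archimedean Whittaker integral times the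
  local Whittaker integrals at the places of `T`; **`jointWhittaker_eq_sum_mul_prod_of_sum_tensor`** — the same for a standard family's `T`-part written as a FINITE SUM of
  pure tensors (K-finite vectors; ⊗-pure = the case `m = 1`), each summand's joint integrand integrable BY VALUE.
«Continued = integral» per place and the assembly of the ∃-head `exists_kindW_eulerLetters` are NOT here ((x-a) ED. 2; (x-b) K2E4-p10 (g9) `K2LiuSiegelEisensteinKindWInstance`).
HONEST LABEL.  Count-neutral helper; it retires nothing by itself: `HC_CM` is proved only modulo the 7 printed citations (2 remaining named inputs:
hLiu418 = `stmt-HodgeConjecture-24832`, h413 = `stmt-HodgeConjecture-24833`) until rung 0 closes.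

## References
* [KudlaRallis1994] S. Kudla, S. Rallis, Ann. of Math. 140 (1994): §1 (the non-singular Fourier coefficient is a product of local Whittaker integrals).
* [Tan1999] V. Tan, Canad. J. Math. 51 (1999): §2–§3 (`W_β(s) = ⊗_v W_{β,v}(s)` for factorizable sections).
* [CasselsFrohlichANT1967] Cassels–Fröhlich (eds.), *Algebraic Number Theory* (1967): Ch. XV (Tate) §3.3 (Fubini on finite products of local fields).
* [Folland1995] G. B. Folland, *A Course in Abstract Harmonic Analysis* (1995): §2.3 (product Haar measures, Fubini–Tonelli).
-/

set_option autoImplicit false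
-- the mandated namespace repeats the single-problem summit's segment (`HodgeConjecture.HodgeConjecture`)
set_option linter.dupNamespace false

noncomputable section

open scoped Matrix ENNReal NNReal Topology ComplexConjugate BigOperators
open NumberField IsDedekindDomain MeasureTheory Measure Filter Set

namespace Summit.HodgeConjecture.HodgeConjecture.Cruxes.HLiu418.K2LiuSiegelEisensteinKindWPartFubini

/-! ## §1 Generic Fubini for a tensor integrand on `μ ⊗ ⊗_{i∈ι} ν_i` -/

section Generic

variable {X : Type*} [MeasurableSpace X] {ι : Type*} [Fintype ι] {Y : ι → Type*} [∀ i, MeasurableSpace (Y i)]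
  (μ : Measure X) [SFinite μ] (ν : ∀ i, Measure (Y i)) [∀ i, SigmaFinite (ν i)]

/-- **FUBINI FOR A TENSOR INTEGRAND**: `∫ (φ(x)·∏ᵢ ψᵢ(yᵢ)) · (g(x)·∏ᵢ kᵢ(yᵢ)) d(μ ⊗ ⊗ᵢ νᵢ) = (∫ φ·g dμ) · ∏ᵢ ∫ ψᵢ·kᵢ dνᵢ` (Mathlib `integral_prod_mul`, `integral_fintype_prod_eq_prod`;
no integrability hypothesis — both sides vanish together). [cite: Folland1995, §2.3] -/
theorem integral_prod_pi_tensor (φ g : X → ℂ) (ψ k : ∀ i, Y i → ℂ) :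
    ∫ p : X × (∀ i, Y i), (φ p.1 * ∏ i, ψ i (p.2 i)) * (g p.1 * ∏ i, k i (p.2 i)) ∂(μ.prod (Measure.pi ν)) =
      (∫ x, φ x * g x ∂μ) * ∏ i, ∫ y, ψ i y * k i y ∂(ν i) := by
  have h1 : ∀ p : X × (∀ i, Y i), (φ p.1 * ∏ i, ψ i (p.2 i)) * (g p.1 * ∏ i, k i (p.2 i)) =
      (φ p.1 * g p.1) * ∏ i, (ψ i (p.2 i) * k i (p.2 i)) := fun p => by
    rw [Finset.prod_mul_distrib]; ring
  simp_rw [h1]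
  rw [integral_prod_mul (fun x => φ x * g x) (fun y : ∀ i, Y i => ∏ i, (ψ i (y i) * k i (y i))),
    integral_fintype_prod_eq_prod (fun i y => ψ i y * k i y)]

/-- **the finite-sum-of-pure-tensors twin**: for `g = Σ_{j<m} g_j ⊗ (⊗ᵢ k_{j,i})` with each summand's integrand integrable,
`∫ (φ(x)·∏ᵢ ψᵢ(yᵢ)) · Σ_j (g_j(x)·∏ᵢ k_{j,i}(yᵢ)) = Σ_j (∫ φ·g_j dμ) · ∏ᵢ ∫ ψᵢ·k_{j,i} dνᵢ`. [cite: Folland1995, §2.3] -/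
theorem integral_prod_pi_sum_tensor (φ : X → ℂ) (ψ : ∀ i, Y i → ℂ) {m : ℕ} (g : Fin m → X → ℂ) (k : Fin m → ∀ i, Y i → ℂ)
    (hint : ∀ j, Integrable (fun p : X × (∀ i, Y i) => (φ p.1 * ∏ i, ψ i (p.2 i)) * (g j p.1 * ∏ i, k j i (p.2 i))) (μ.prod (Measure.pi ν))) :
    ∫ p : X × (∀ i, Y i), (φ p.1 * ∏ i, ψ i (p.2 i)) * (∑ j, g j p.1 * ∏ i, k j i (p.2 i)) ∂(μ.prod (Measure.pi ν)) =
      ∑ j, (∫ x, φ x * g j x ∂μ) * ∏ i, ∫ y, ψ i y * k j i y ∂(ν i) := by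
  simp_rw [Finset.mul_sum]
  rw [integral_finsetSum _ (fun j _ => hint j)]
  exact Finset.sum_congr rfl fun j _ => integral_prod_pi_tensor μ ν φ (g j) ψ (k j)

end Generic

/-! ## §2 The joint archimedean × `T` Whittaker integral of a ⊗-pure `T`-part -/

section Whittaker

open Literature.NumberTheory.Automorphic Literature.NumberTheory.GaloisRepresentations
open Literature.NumberTheory.GelbartRogawski1991 Literature.NumberTheory.GelbartRogawski1991.GRConstruction
open Literature.NumberTheory.K2Lit.SiegelDoubled
open Literature.NumberTheory.K2Lit.PlaceSplitting
open Summit.HodgeConjecture.HodgeConjecture.Cruxes.HLiu418.K2LiuSiegelUnipotentLocalDefs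
open Summit.HodgeConjecture.HodgeConjecture.Cruxes.HLiu418.K2LiuSiegelUnipotentSplitDefs
open Summit.HodgeConjecture.HodgeConjecture.Cruxes.HLiu418.K2LiuSiegelUnipotentSplitAtDefs
open Summit.HodgeConjecture.HodgeConjecture.Cruxes.HLiu418.K2LiuSiegelUnipotentFourierDefs

variable (L : Type) [Field L] [NumberField L] [IsCMField L]
variable {N M n : ℕ} (e : Fin N × Fin M ≃ Fin n)
  (dV : Fin N → L) (hdV : ∀ i, IsCMField.complexConj L (dV i) = dV i)
  (dW : Fin M → L) (hdW : ∀ i, IsCMField.complexConj L (dW i) = dW i)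
  [MeasurableSpace ↥(unipDeltaArch L e dV hdV dW hdW)]
  [∀ v : HeightOneSpectrum (𝓞 (Fp L)), MeasurableSpace ↥(unipDeltaLoc L e dV hdV dW hdW v)]

set_option maxHeartbeats 400000 in -- MEASURED (fails at the default 200 000 — `isDefEq` of the final `exact` —, passes at 400 000): the adelic doubled unitary datum's coercion tower in the integrand; plain `simp_rw` + `exact`, no search tactics
/-- **`I_T(S,s,h) = W_{S,∞}(s) · ∏_{v∈T} W_{S,v}(s)` FOR A ⊗-PURE `T`-PART.**  If `fT_s(a, x) = F_∞(s)(a) · ∏_{v∈T} F_v(s)(x_v)` (`hpure`), then ★ G1's joint archimedean × `T`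
integral (the body of (x-a) ED. 1 `kindWPart T νinf νv fT S s h`) is the archimedean Whittaker integral `∫ conj ψ_S(p_∞,1) · F_∞(s)(w_Δ p_∞ h_∞) dν_∞` times the local
Whittaker integrals `∫ conj ψ_S(ι_v y) · F_v(s)((w_Δ)_v y h_v) dν_v`, `v ∈ T`. [cite: KudlaRallis1994, §1] [cite: Tan1999, §2–§3] [cite: CasselsFrohlichANT1967, Ch. XV §3.3] -/
theorem jointWhittaker_eq_mul_prod_of_tensor (T : Finset (HeightOneSpectrum (𝓞 (Fp L))))
    (νinf : Measure ↥(unipDeltaArch L e dV hdV dW hdW)) [SFinite νinf]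
    (νv : ∀ v : HeightOneSpectrum (𝓞 (Fp L)), Measure ↥(unipDeltaLoc L e dV hdV dW hdW v)) [∀ v, SigmaFinite (νv v)]
    {fT : ℂ → UnitaryGroup.arch (Fp L) L (IsCMField.complexConj L) (n + n) (hermD L e dV hdV dW hdW) ×
      (Π v : T, UnitaryGroup.localPi L (IsCMField.complexConj L) (n + n) (hermD L e dV hdV dW hdW) v.1) → ℂ}
    {Finf : ℂ → UnitaryGroup.arch (Fp L) L (IsCMField.complexConj L) (n + n) (hermD L e dV hdV dW hdW) → ℂ}
    {Fv : ∀ v : T, ℂ → UnitaryGroup.localPi L (IsCMField.complexConj L) (n + n) (hermD L e dV hdV dW hdW) v.1 → ℂ}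
    (hpure : ∀ (s : ℂ) (a : UnitaryGroup.arch (Fp L) L (IsCMField.complexConj L) (n + n) (hermD L e dV hdV dW hdW))
      (x : Π v : T, UnitaryGroup.localPi L (IsCMField.complexConj L) (n + n) (hermD L e dV hdV dW hdW) v.1), fT s (a, x) = Finf s a * ∏ v : T, Fv v s (x v))
    (S : Matrix (Fin n) (Fin n) L) (s : ℂ) (h : HA L e dV hdV dW hdW) :
    (∫ p, (conj (unipDeltaChar L e dV hdV dW hdW S
            (UnitaryGroup.archToAdelic (Fp L) L (IsCMField.complexConj L) (n + n) (hermD L e dV hdV dW hdW)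
              (p.1 : UnitaryGroup.arch (Fp L) L (IsCMField.complexConj L) (n + n) (hermD L e dV hdV dW hdW))) : ℂ) *
          ∏ v : T, conj (unipDeltaChar L e dV hdV dW hdW S
            (locToAdelic L e dV hdV dW hdW v.1
              ((p.2 v : ↥(unipDeltaLoc L e dV hdV dW hdW v.1)) : UnitaryGroup.localPi L (IsCMField.complexConj L) (n + n) (hermD L e dV hdV dW hdW) v.1)) : ℂ)) *
        fT s (UnitaryGroup.archPart (Fp L) L (IsCMField.complexConj L) (n + n) (hermD L e dV hdV dW hdW) (weylDelta L e dV hdV dW hdW) *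
              (p.1 : UnitaryGroup.arch (Fp L) L (IsCMField.complexConj L) (n + n) (hermD L e dV hdV dW hdW)) *
              UnitaryGroup.archPart (Fp L) L (IsCMField.complexConj L) (n + n) (hermD L e dV hdV dW hdW) h,
            fun v : T => UnitaryGroup.evalPlace (Fp L) L (IsCMField.complexConj L) (n + n) (hermD L e dV hdV dW hdW) v.1
                (UnitaryGroup.finPart (Fp L) L (IsCMField.complexConj L) (n + n) (hermD L e dV hdV dW hdW) (weylDelta L e dV hdV dW hdW)) *
              ((p.2 v : ↥(unipDeltaLoc L e dV hdV dW hdW v.1)) : UnitaryGroup.localPi L (IsCMField.complexConj L) (n + n) (hermD L e dV hdV dW hdW) v.1) *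
              UnitaryGroup.evalPlace (Fp L) L (IsCMField.complexConj L) (n + n) (hermD L e dV hdV dW hdW) v.1
                (UnitaryGroup.finPart (Fp L) L (IsCMField.complexConj L) (n + n) (hermD L e dV hdV dW hdW) h))
        ∂(νinf.prod (Measure.pi fun v : T => νv v.1))) =
      (∫ a, conj (unipDeltaChar L e dV hdV dW hdW S
            (UnitaryGroup.archToAdelic (Fp L) L (IsCMField.complexConj L) (n + n) (hermD L e dV hdV dW hdW)
              (a : UnitaryGroup.arch (Fp L) L (IsCMField.complexConj L) (n + n) (hermD L e dV hdV dW hdW))) : ℂ) *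
          Finf s (UnitaryGroup.archPart (Fp L) L (IsCMField.complexConj L) (n + n) (hermD L e dV hdV dW hdW) (weylDelta L e dV hdV dW hdW) *
              (a : UnitaryGroup.arch (Fp L) L (IsCMField.complexConj L) (n + n) (hermD L e dV hdV dW hdW)) *
              UnitaryGroup.archPart (Fp L) L (IsCMField.complexConj L) (n + n) (hermD L e dV hdV dW hdW) h) ∂νinf) *
        ∏ v : T, ∫ y, conj (unipDeltaChar L e dV hdV dW hdW S
            (locToAdelic L e dV hdV dW hdW v.1
              ((y : ↥(unipDeltaLoc L e dV hdV dW hdW v.1)) : UnitaryGroup.localPi L (IsCMField.complexConj L) (n + n) (hermD L e dV hdV dW hdW) v.1)) : ℂ) *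
          Fv v s (UnitaryGroup.evalPlace (Fp L) L (IsCMField.complexConj L) (n + n) (hermD L e dV hdV dW hdW) v.1
                (UnitaryGroup.finPart (Fp L) L (IsCMField.complexConj L) (n + n) (hermD L e dV hdV dW hdW) (weylDelta L e dV hdV dW hdW)) *
              ((y : ↥(unipDeltaLoc L e dV hdV dW hdW v.1)) : UnitaryGroup.localPi L (IsCMField.complexConj L) (n + n) (hermD L e dV hdV dW hdW) v.1) *
              UnitaryGroup.evalPlace (Fp L) L (IsCMField.complexConj L) (n + n) (hermD L e dV hdV dW hdW) v.1
                (UnitaryGroup.finPart (Fp L) L (IsCMField.complexConj L) (n + n) (hermD L e dV hdV dW hdW) h)) ∂(νv v.1) := by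
  simp_rw [hpure]
  exact integral_prod_pi_tensor νinf (fun v : T => νv v.1)
    (fun a => conj (unipDeltaChar L e dV hdV dW hdW S
      (UnitaryGroup.archToAdelic (Fp L) L (IsCMField.complexConj L) (n + n) (hermD L e dV hdV dW hdW)
        (a : UnitaryGroup.arch (Fp L) L (IsCMField.complexConj L) (n + n) (hermD L e dV hdV dW hdW))) : ℂ))
    (fun a => Finf s (UnitaryGroup.archPart (Fp L) L (IsCMField.complexConj L) (n + n) (hermD L e dV hdV dW hdW) (weylDelta L e dV hdV dW hdW) *
      (a : UnitaryGroup.arch (Fp L) L (IsCMField.complexConj L) (n + n) (hermD L e dV hdV dW hdW)) *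
      UnitaryGroup.archPart (Fp L) L (IsCMField.complexConj L) (n + n) (hermD L e dV hdV dW hdW) h))
    (fun (v : T) (y : ↥(unipDeltaLoc L e dV hdV dW hdW v.1)) => conj (unipDeltaChar L e dV hdV dW hdW S
      (locToAdelic L e dV hdV dW hdW v.1
        ((y : ↥(unipDeltaLoc L e dV hdV dW hdW v.1)) : UnitaryGroup.localPi L (IsCMField.complexConj L) (n + n) (hermD L e dV hdV dW hdW) v.1)) : ℂ))
    (fun (v : T) (y : ↥(unipDeltaLoc L e dV hdV dW hdW v.1)) =>
      Fv v s (UnitaryGroup.evalPlace (Fp L) L (IsCMField.complexConj L) (n + n) (hermD L e dV hdV dW hdW) v.1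
          (UnitaryGroup.finPart (Fp L) L (IsCMField.complexConj L) (n + n) (hermD L e dV hdV dW hdW) (weylDelta L e dV hdV dW hdW)) *
        ((y : ↥(unipDeltaLoc L e dV hdV dW hdW v.1)) : UnitaryGroup.localPi L (IsCMField.complexConj L) (n + n) (hermD L e dV hdV dW hdW) v.1) *
        UnitaryGroup.evalPlace (Fp L) L (IsCMField.complexConj L) (n + n) (hermD L e dV hdV dW hdW) v.1
          (UnitaryGroup.finPart (Fp L) L (IsCMField.complexConj L) (n + n) (hermD L e dV hdV dW hdW) h)))

set_option maxHeartbeats 400000 in -- MEASURED (as `jointWhittaker_eq_mul_prod_of_tensor`: the default 200 000 fails at `isDefEq` of the final `exact`, 400 000 passes)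
/-- **THE FINITE-SUM-OF-PURE-TENSORS TWIN** (a standard family's `T`-part is `K`-finite, hence a finite sum of pure tensors at the places of `T ∪ ∞`): if
`fT_s(a, x) = Σ_{j<m} F_{∞,j}(s)(a) · ∏_{v∈T} F_{v,j}(s)(x_v)` and each summand's joint integrand is integrable, then
`I_T(S,s,h) = Σ_j (∫ conj ψ_S(p_∞,1) · F_{∞,j}(s)(w_Δ p_∞ h_∞) dν_∞) · ∏_{v∈T} ∫ conj ψ_S(ι_v y) · F_{v,j}(s)((w_Δ)_v y h_v) dν_v`.
[cite: KudlaRallis1994, §1] [cite: Tan1999, §2–§3] [cite: CasselsFrohlichANT1967, Ch. XV §3.3] -/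
theorem jointWhittaker_eq_sum_mul_prod_of_sum_tensor (T : Finset (HeightOneSpectrum (𝓞 (Fp L))))
    (νinf : Measure ↥(unipDeltaArch L e dV hdV dW hdW)) [SFinite νinf]
    (νv : ∀ v : HeightOneSpectrum (𝓞 (Fp L)), Measure ↥(unipDeltaLoc L e dV hdV dW hdW v)) [∀ v, SigmaFinite (νv v)]
    {fT : ℂ → UnitaryGroup.arch (Fp L) L (IsCMField.complexConj L) (n + n) (hermD L e dV hdV dW hdW) ×
      (Π v : T, UnitaryGroup.localPi L (IsCMField.complexConj L) (n + n) (hermD L e dV hdV dW hdW) v.1) → ℂ} {m : ℕ}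
    {Finf : Fin m → ℂ → UnitaryGroup.arch (Fp L) L (IsCMField.complexConj L) (n + n) (hermD L e dV hdV dW hdW) → ℂ}
    {Fv : Fin m → ∀ v : T, ℂ → UnitaryGroup.localPi L (IsCMField.complexConj L) (n + n) (hermD L e dV hdV dW hdW) v.1 → ℂ}
    (hsum : ∀ (s : ℂ) (a : UnitaryGroup.arch (Fp L) L (IsCMField.complexConj L) (n + n) (hermD L e dV hdV dW hdW))
      (x : Π v : T, UnitaryGroup.localPi L (IsCMField.complexConj L) (n + n) (hermD L e dV hdV dW hdW) v.1),
      fT s (a, x) = ∑ j, Finf j s a * ∏ v : T, Fv j v s (x v))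
    (S : Matrix (Fin n) (Fin n) L) (s : ℂ) (h : HA L e dV hdV dW hdW)
    (hint : ∀ j, Integrable (fun p : ↥(unipDeltaArch L e dV hdV dW hdW) × (Π v : T, ↥(unipDeltaLoc L e dV hdV dW hdW v.1)) =>
      (conj (unipDeltaChar L e dV hdV dW hdW S
            (UnitaryGroup.archToAdelic (Fp L) L (IsCMField.complexConj L) (n + n) (hermD L e dV hdV dW hdW)
              (p.1 : UnitaryGroup.arch (Fp L) L (IsCMField.complexConj L) (n + n) (hermD L e dV hdV dW hdW))) : ℂ) *
          ∏ v : T, conj (unipDeltaChar L e dV hdV dW hdW S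
            (locToAdelic L e dV hdV dW hdW v.1
              ((p.2 v : ↥(unipDeltaLoc L e dV hdV dW hdW v.1)) : UnitaryGroup.localPi L (IsCMField.complexConj L) (n + n) (hermD L e dV hdV dW hdW) v.1)) : ℂ)) *
        (Finf j s (UnitaryGroup.archPart (Fp L) L (IsCMField.complexConj L) (n + n) (hermD L e dV hdV dW hdW) (weylDelta L e dV hdV dW hdW) *
              (p.1 : UnitaryGroup.arch (Fp L) L (IsCMField.complexConj L) (n + n) (hermD L e dV hdV dW hdW)) *
              UnitaryGroup.archPart (Fp L) L (IsCMField.complexConj L) (n + n) (hermD L e dV hdV dW hdW) h) *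
          ∏ v : T, Fv j v s (UnitaryGroup.evalPlace (Fp L) L (IsCMField.complexConj L) (n + n) (hermD L e dV hdV dW hdW) v.1
                (UnitaryGroup.finPart (Fp L) L (IsCMField.complexConj L) (n + n) (hermD L e dV hdV dW hdW) (weylDelta L e dV hdV dW hdW)) *
              ((p.2 v : ↥(unipDeltaLoc L e dV hdV dW hdW v.1)) : UnitaryGroup.localPi L (IsCMField.complexConj L) (n + n) (hermD L e dV hdV dW hdW) v.1) *
              UnitaryGroup.evalPlace (Fp L) L (IsCMField.complexConj L) (n + n) (hermD L e dV hdV dW hdW) v.1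
                (UnitaryGroup.finPart (Fp L) L (IsCMField.complexConj L) (n + n) (hermD L e dV hdV dW hdW) h)))) (νinf.prod (Measure.pi fun v : T => νv v.1))) :
    (∫ p, (conj (unipDeltaChar L e dV hdV dW hdW S
            (UnitaryGroup.archToAdelic (Fp L) L (IsCMField.complexConj L) (n + n) (hermD L e dV hdV dW hdW)
              (p.1 : UnitaryGroup.arch (Fp L) L (IsCMField.complexConj L) (n + n) (hermD L e dV hdV dW hdW))) : ℂ) *
          ∏ v : T, conj (unipDeltaChar L e dV hdV dW hdW S
            (locToAdelic L e dV hdV dW hdW v.1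
              ((p.2 v : ↥(unipDeltaLoc L e dV hdV dW hdW v.1)) : UnitaryGroup.localPi L (IsCMField.complexConj L) (n + n) (hermD L e dV hdV dW hdW) v.1)) : ℂ)) *
        fT s (UnitaryGroup.archPart (Fp L) L (IsCMField.complexConj L) (n + n) (hermD L e dV hdV dW hdW) (weylDelta L e dV hdV dW hdW) *
              (p.1 : UnitaryGroup.arch (Fp L) L (IsCMField.complexConj L) (n + n) (hermD L e dV hdV dW hdW)) *
              UnitaryGroup.archPart (Fp L) L (IsCMField.complexConj L) (n + n) (hermD L e dV hdV dW hdW) h,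
            fun v : T => UnitaryGroup.evalPlace (Fp L) L (IsCMField.complexConj L) (n + n) (hermD L e dV hdV dW hdW) v.1
                (UnitaryGroup.finPart (Fp L) L (IsCMField.complexConj L) (n + n) (hermD L e dV hdV dW hdW) (weylDelta L e dV hdV dW hdW)) *
              ((p.2 v : ↥(unipDeltaLoc L e dV hdV dW hdW v.1)) : UnitaryGroup.localPi L (IsCMField.complexConj L) (n + n) (hermD L e dV hdV dW hdW) v.1) *
              UnitaryGroup.evalPlace (Fp L) L (IsCMField.complexConj L) (n + n) (hermD L e dV hdV dW hdW) v.1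
                (UnitaryGroup.finPart (Fp L) L (IsCMField.complexConj L) (n + n) (hermD L e dV hdV dW hdW) h))
        ∂(νinf.prod (Measure.pi fun v : T => νv v.1))) =
      ∑ j, (∫ a, conj (unipDeltaChar L e dV hdV dW hdW S
            (UnitaryGroup.archToAdelic (Fp L) L (IsCMField.complexConj L) (n + n) (hermD L e dV hdV dW hdW)
              (a : UnitaryGroup.arch (Fp L) L (IsCMField.complexConj L) (n + n) (hermD L e dV hdV dW hdW))) : ℂ) *
          Finf j s (UnitaryGroup.archPart (Fp L) L (IsCMField.complexConj L) (n + n) (hermD L e dV hdV dW hdW) (weylDelta L e dV hdV dW hdW) *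
              (a : UnitaryGroup.arch (Fp L) L (IsCMField.complexConj L) (n + n) (hermD L e dV hdV dW hdW)) *
              UnitaryGroup.archPart (Fp L) L (IsCMField.complexConj L) (n + n) (hermD L e dV hdV dW hdW) h) ∂νinf) *
        ∏ v : T, ∫ y, conj (unipDeltaChar L e dV hdV dW hdW S
            (locToAdelic L e dV hdV dW hdW v.1
              ((y : ↥(unipDeltaLoc L e dV hdV dW hdW v.1)) : UnitaryGroup.localPi L (IsCMField.complexConj L) (n + n) (hermD L e dV hdV dW hdW) v.1)) : ℂ) *
          Fv j v s (UnitaryGroup.evalPlace (Fp L) L (IsCMField.complexConj L) (n + n) (hermD L e dV hdV dW hdW) v.1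
                (UnitaryGroup.finPart (Fp L) L (IsCMField.complexConj L) (n + n) (hermD L e dV hdV dW hdW) (weylDelta L e dV hdV dW hdW)) *
              ((y : ↥(unipDeltaLoc L e dV hdV dW hdW v.1)) : UnitaryGroup.localPi L (IsCMField.complexConj L) (n + n) (hermD L e dV hdV dW hdW) v.1) *
              UnitaryGroup.evalPlace (Fp L) L (IsCMField.complexConj L) (n + n) (hermD L e dV hdV dW hdW) v.1
                (UnitaryGroup.finPart (Fp L) L (IsCMField.complexConj L) (n + n) (hermD L e dV hdV dW hdW) h)) ∂(νv v.1) := by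
  simp_rw [hsum]
  exact integral_prod_pi_sum_tensor νinf (fun v : T => νv v.1)
    (fun a => conj (unipDeltaChar L e dV hdV dW hdW S
      (UnitaryGroup.archToAdelic (Fp L) L (IsCMField.complexConj L) (n + n) (hermD L e dV hdV dW hdW)
        (a : UnitaryGroup.arch (Fp L) L (IsCMField.complexConj L) (n + n) (hermD L e dV hdV dW hdW))) : ℂ))
    (fun (v : T) (y : ↥(unipDeltaLoc L e dV hdV dW hdW v.1)) => conj (unipDeltaChar L e dV hdV dW hdW S
      (locToAdelic L e dV hdV dW hdW v.1
        ((y : ↥(unipDeltaLoc L e dV hdV dW hdW v.1)) : UnitaryGroup.localPi L (IsCMField.complexConj L) (n + n) (hermD L e dV hdV dW hdW) v.1)) : ℂ))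
    (fun j a => Finf j s (UnitaryGroup.archPart (Fp L) L (IsCMField.complexConj L) (n + n) (hermD L e dV hdV dW hdW) (weylDelta L e dV hdV dW hdW) *
              (a : UnitaryGroup.arch (Fp L) L (IsCMField.complexConj L) (n + n) (hermD L e dV hdV dW hdW)) *
              UnitaryGroup.archPart (Fp L) L (IsCMField.complexConj L) (n + n) (hermD L e dV hdV dW hdW) h))
    (fun j (v : T) (y : ↥(unipDeltaLoc L e dV hdV dW hdW v.1)) => Fv j v s (UnitaryGroup.evalPlace (Fp L) L (IsCMField.complexConj L) (n + n) (hermD L e dV hdV dW hdW) v.1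
                (UnitaryGroup.finPart (Fp L) L (IsCMField.complexConj L) (n + n) (hermD L e dV hdV dW hdW) (weylDelta L e dV hdV dW hdW)) *
              ((y : ↥(unipDeltaLoc L e dV hdV dW hdW v.1)) : UnitaryGroup.localPi L (IsCMField.complexConj L) (n + n) (hermD L e dV hdV dW hdW) v.1) *
              UnitaryGroup.evalPlace (Fp L) L (IsCMField.complexConj L) (n + n) (hermD L e dV hdV dW hdW) v.1
                (UnitaryGroup.finPart (Fp L) L (IsCMField.complexConj L) (n + n) (hermD L e dV hdV dW hdW) h)))
    hint

end Whittaker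

end Summit.HodgeConjecture.HodgeConjecture.Cruxes.HLiu418.K2LiuSiegelEisensteinKindWPartFubini

end
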